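import Literature.IUT.LogVolume.TensorPacketModel
import Literature.NumberTheory.NumberFields.RescaledCompletion
import HarnessLib

/-!
# The GENUINE local-field family of an extension of number fields: completions at a section of places
# ([IUTchI] Def. 3.1 (e); Dupuy–Hilado Def. 3.6.1 "`K_{v̲}`")

[IUTchI] Def. 3.1 (e) (kurims May-2020 manuscript p. 62): "`V̲ ⊆ V(K)` is a subset that induces a natural
bijection `V̲ ⥲ V_mod`, i.e., a section of the natural surjection `V(K) ↠ V_mod`". Dupuy–Hilado,
arXiv:2004.13228 (pre-split text) Def. 3.6.1 (render chunk 11): "`𝔸^{⊗ r+1}_{V̲,p} =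
⊕_{(v_0,…,v_r)} K_{v̲_0} ⊗ ⋯ ⊗ K_{v̲_r}` … the tensor products are taken over `ℚ_p`", the fields `K_{v̲}` being
the COMPLETIONS of the number field `K` of the initial Θ-data at the chosen places `v̲ ∈ V̲` over `v ∈ V_mod`.

The real tensor-packet model of the cell (abc-iut-c312-3, `TensorPacketModel.lean`) takes as INPUT an
abstract family `𝔽 : LocalFieldFamily F₀` — for every prime `p` and place `v ∈ V(F₀)_p` a field of the
norm-side MLF class (nontrivially normed field, normed `ℚ_p`-algebra, ultrametric, proper) "standing for the
completion … at a chosen place `v̲ | v`". This file BUILDS that input from arithmetic data, so that the packets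
`⊗_{ℚ_p} K_{v̲_i}`, the log-shells, the Haar log-volumes and the hulls of the model are those of the ACTUAL
completions:

* `PlaceSection F₀ K` — a section `v ↦ v̲` of the restriction of finite places `V(K)^non → V(F₀)^non`
  (Mathlib `HeightOneSpectrum.under`), the nonarchimedean part of [IUTchI] Def. 3.1 (e)'s `V̲ ⥲ V_mod`
  (with `F₀` in the role of `F_mod`); `PlaceSection.nonempty` (a prime of `𝓞_K` lies over every prime of
  `𝓞_{F₀}`, Mathlib `Ideal.exists_maximal_ideal_liesOver_of_isIntegral`);
* `PlaceSection.localFields σ p : LocalFields F₀ p` — `K_{v̲} :=` abc-iut-S7's `RescaledCompletion K p v̲`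
  (the completion `v̲.adicCompletion K` normed by `‖·‖_{v̲}^{1/n_{v̲}}`, a normed `ℚ_p`-algebra, ultrametric,
  complete, proper, nontrivially normed — `Literature/NumberTheory/NumberFields/RescaledCompletion.lean`),
  and the family `PlaceSection.localFieldFamily σ : LocalFieldFamily F₀` over all primes;
* `PlaceSection.packetModel σ : IndPacketModel F₀ := tensorPacketModel σ.localFieldFamily` — the
  Dupuy–Hilado / [IUTchIII] §3 tensor-packet model over the GENUINE completions; at a prime `p` its `p`-part
  is `realPrimePacket p (σ.localFields p)` (`packetModel_primePart`, from c312-3's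
  `primePart_tensorPacketModel`).

Classical background for completions and local degrees: Neukirch, ANT, Ch. II (4.8), (6.8), (8.5).
[cite: NeukirchANT1999, Ch. II Thm. (4.8)] [cite: DupuyHilado2025, Def. 3.6.1]
[cite: Mochizuki2012, IUTchI Def. 3.1 (e) p. 62] An instance ≠ an endorsement: nothing here bears on whether
[IUTchIII] Thm. 3.11 licenses Dupuy–Hilado's (1.1) / [IUTchIII] Cor. 3.12. Deliberately NOT here: the
archimedean members of `V̲` (the archimedean packets are abc-iut-L5-t7's `ArchimedeanPacketLogVolume`), the
ideles realising the pilot divisors in `K_{v̲}` (a summit-side `DHData`), anything disputed.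
-/

noncomputable section

namespace Literature.IUT.LogVolume

open NumberField IsDedekindDomain Literature.NumberTheory.NumberFields

variable (F₀ : Type) [Field F₀] (K : Type) [Field K] [Algebra F₀ K]

/-! ## Sections of the finite places along `K / F₀` -/

/-- **A section of the finite places of `K` over those of `F₀`**: for every finite place `v` of `F₀` a
finite place `v̲ = lift v` of `K` lying over it (`v̲ ∩ 𝓞_{F₀} = v`). The nonarchimedean part of [IUTchI]
Def. 3.1 (e): "`V̲ ⊆ V(K)` is a subset that induces a natural bijection `V̲ ⥲ V_mod`, i.e., a section of the
natural surjection `V(K) ↠ V_mod`" (here `F₀` in the role of `F_mod`). [cite: Mochizuki2012, IUTchI Def. 3.1 (e) p. 62] -/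
structure PlaceSection : Type where
  /-- the chosen place `v̲` of `K` over the finite place `v` of `F₀` -/
  lift : HeightOneSpectrum (𝓞 F₀) → HeightOneSpectrum (𝓞 K)
  /-- `v̲` lies over `v`: `v̲ ∩ 𝓞_{F₀} = v` -/
  under_lift : ∀ v, (lift v).under (𝓞 F₀) = v

namespace PlaceSection

variable {F₀ K}

/-- Over every finite place of `F₀` there is a finite place of `K` (`𝓞_K` is integral over `𝓞_{F₀}`; going
up). [cite: NeukirchANT1999, Ch. I §8] -/
theorem exists_under_eq [NumberField F₀] (v : HeightOneSpectrum (𝓞 F₀)) : ∃ w : HeightOneSpectrum (𝓞 K), w.under (𝓞 F₀) = v := by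
  haveI := v.isPrime.isMaximal v.ne_bot
  obtain ⟨P, hPmax, hP⟩ := Ideal.exists_maximal_ideal_liesOver_of_isIntegral (S := 𝓞 K) v.asIdeal
  exact ⟨⟨P, hPmax.isPrime, Ideal.ne_bot_of_liesOver_of_ne_bot v.ne_bot P⟩, HeightOneSpectrum.ext hP.over.symm⟩

variable (F₀ K) in
/-- Sections of the finite places exist ("a section of the natural surjection `V(K) ↠ V_mod`").
[cite: Mochizuki2012, IUTchI Def. 3.1 (e) p. 62] -/
theorem nonempty [NumberField F₀] : Nonempty (PlaceSection F₀ K) :=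
  ⟨{ lift := fun v => (exists_under_eq v).choose
     under_lift := fun v => (exists_under_eq v).choose_spec }⟩

variable (σ : PlaceSection F₀ K)

/-- The ideal of `v̲` restricts to that of `v`. [cite: Mochizuki2012, IUTchI Def. 3.1 (e) p. 62] -/
theorem under_asIdeal_lift (v : HeightOneSpectrum (𝓞 F₀)) : (σ.lift v).asIdeal.under (𝓞 F₀) = v.asIdeal := by
  rw [← HeightOneSpectrum.under_asIdeal, σ.under_lift]

/-- `v̲` lies over `v` (Mathlib's `LiesOver`). [cite: Mochizuki2012, IUTchI Def. 3.1 (e) p. 62] -/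
theorem liesOver_lift (v : HeightOneSpectrum (𝓞 F₀)) : (σ.lift v).asIdeal.LiesOver v.asIdeal :=
  ⟨(σ.under_asIdeal_lift v).symm⟩

/-- An element of `𝓞_{F₀}` lies in `v` iff its image lies in `v̲`. [cite: Mochizuki2012, IUTchI Def. 3.1 (e) p. 62] -/
theorem algebraMap_mem_lift_iff (v : HeightOneSpectrum (𝓞 F₀)) (x : 𝓞 F₀) :
    algebraMap (𝓞 F₀) (𝓞 K) x ∈ (σ.lift v).asIdeal ↔ x ∈ v.asIdeal := by
  rw [← Ideal.mem_comap]
  change x ∈ (σ.lift v).asIdeal.under (𝓞 F₀) ↔ _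
  rw [σ.under_asIdeal_lift]

/-- The section is injective (distinct places of `F₀` have distinct lifts).
[cite: Mochizuki2012, IUTchI Def. 3.1 (e) p. 62] -/
theorem lift_injective : Function.Injective σ.lift := fun v v' h => by
  rw [← σ.under_lift v, ← σ.under_lift v', h]

variable [NumberField F₀] [NumberField K]

/-- `v̲` lies over the rational prime under `v`: `v̲ ∈ V(K)_p` for `v ∈ V(F₀)_p` (transitivity of
"lies over"). [cite: NeukirchANT1999, Ch. I §8] -/
theorem lift_mem_placesOver {p : ℕ} [Fact p.Prime] (v : placesOver F₀ p) : σ.lift v.1 ∈ placesOver K p := by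
  haveI := σ.liesOver_lift v.1
  haveI : v.1.asIdeal.LiesOver (Ideal.span {(p : ℤ)}) := (mem_placesOver_iff v.1).mp v.2
  exact (mem_placesOver_iff _).mpr (Ideal.LiesOver.trans (σ.lift v.1).asIdeal v.1.asIdeal _)

/-- If `v` lies over the rational prime `p`, then `p ∈ v̲`. [cite: NeukirchANT1999, Ch. I §8] -/
theorem natCast_mem_lift {p : ℕ} [Fact p.Prime] (v : placesOver F₀ p) :
    ((p : ℕ) : 𝓞 K) ∈ (σ.lift v.1).asIdeal := by
  have h := (mem_placesOver_iff (σ.lift v.1)).mp (σ.lift_mem_placesOver v)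
  have hmem : (p : ℤ) ∈ (σ.lift v.1).asIdeal.under ℤ := by
    rw [← h.over]; exact Ideal.mem_span_singleton_self _
  have := Ideal.mem_comap.mp hmem
  simpa using this

/-! ## The completions at the section as a `LocalFieldFamily` -/

/-- **The local fields at the places over `p`, GENUINE**: `K_{v̲} :=` the completion of `K` at `v̲ = lift v`
with its rescaled norm `‖·‖_{v̲}^{1/n_{v̲}}` (abc-iut-S7's `RescaledCompletion`: a nontrivially normed field,
normed `ℚ_p`-algebra, ultrametric, proper) — Dupuy–Hilado's "`K_{v̲}`" of Def. 3.6.1 for `v ∈ V(F₀)_p`.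
[cite: DupuyHilado2025, Def. 3.6.1] -/
def localFields (p : ℕ) [Fact p.Prime] : LocalFields F₀ p where
  k v := RescaledCompletion K p (σ.lift v.1) (σ.natCast_mem_lift v)

/-- The field at `v` IS the rescaled completion `K_{v̲}` (definitional). [cite: DupuyHilado2025, Def. 3.6.1] -/
theorem localFields_k (p : ℕ) [Fact p.Prime] (v : placesOver F₀ p) :
    (σ.localFields p).k v = RescaledCompletion K p (σ.lift v.1) (σ.natCast_mem_lift v) := rfl

/-- **The local field family of the section**: the completions `K_{v̲}` at the places over every prime.
[cite: DupuyHilado2025, Def. 3.6.1] -/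
def localFieldFamily : LocalFieldFamily F₀ := fun p hp =>
  haveI : Fact p.Prime := ⟨hp⟩
  σ.localFields p

/-- The family at a prime `p` is `localFields σ p` (definitional). [cite: DupuyHilado2025, Def. 3.6.1] -/
theorem localFieldFamily_apply (p : ℕ) [hp : Fact p.Prime] : σ.localFieldFamily p hp.out = σ.localFields p := rfl

/-- `[K_{v̲} : ℚ_p] = n_{v̲} = e(v̲|p)·f(v̲|p)` for the completion in the family (abc-iut-S7's
`localDeg_eq_finrank`, transported along the identity `F_v → RescaledCompletion`).
[cite: NeukirchANT1999, Ch. II Prop. (6.8)] -/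
theorem finrank_localFields_k (p : ℕ) [Fact p.Prime] (v : placesOver F₀ p) :
    Module.finrank ℚ_[p] ((σ.localFields p).k v) = localDeg K (σ.lift v.1) :=
  (RescaledCompletion.localDeg_eq_finrank K p (σ.lift v.1) (σ.natCast_mem_lift v)).symm

/-! ## The tensor-packet model over the genuine completions -/

/-- **The tensor-packet `IndPacketModel` over the GENUINE completions** `K_{v̲}`, `v ∈ V(F₀)`: abc-iut-c312-3's
`tensorPacketModel` (Dupuy–Hilado Def. 3.6.1/3.6.3, §3.7, §4.7, §4.9, §4.12 — every interface axiom a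
theorem) fed with `σ.localFieldFamily`. Its packets are `K_{v̲_0} ⊗_{ℚ_p} ⋯ ⊗_{ℚ_p} K_{v̲_j}` over the actual
completions, its `O_{v⃗}` their `(R_I)^∼`, its log-shells `(2p)^{−(j+1)}·log_p(R_I^×)`, its hulls abc-iut-S2's
`packetHull`. [cite: DupuyHilado2025, Def. 3.6.1, Def. 3.6.3] -/
def packetModel : IndPacketModel F₀ := tensorPacketModel σ.localFieldFamily

/-- At a prime `p` the `p`-part of the genuine model is the real packet over the completions `K_{v̲}`,
`v ∈ V(F₀)_p` (c312-3's `primePart_tensorPacketModel`). [cite: DupuyHilado2025, Def. 3.6.1] -/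
theorem packetModel_primePart (p : ℕ) [hp : Fact p.Prime] :
    σ.packetModel.primePart p = realPrimePacket p (σ.localFields p) :=
  primePart_tensorPacketModel σ.localFieldFamily hp.out

/-- Dupuy–Hilado Thm. 3.10.1 for the genuine model (no interface axiom): the log-volume of the region of an
lgp-idele is minus the normalised lgp-degree of its divisor (c312-3's `lnνL_region_tensorPacketModel`).
[cite: DupuyHilado2025, Thm. 3.10.1] -/
theorem lnνL_region_packetModel {lstar : ℕ} (T : Finset ℕ) (hT : ∀ p ∈ T, p.Prime)
    (t : σ.packetModel.LgpIdele lstar) :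
    σ.packetModel.lnνL lstar T (σ.packetModel.region t) =
      -LgpDivisor.ndegLgp (PacketModel.LgpIdele.div σ.packetModel.toPacketModel t T) :=
  lnνL_region_tensorPacketModel σ.localFieldFamily t T hT

end PlaceSection

end Literature.IUT.LogVolume

end
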